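import Literature.MathematicalPhysics.QuantumFieldTheory.Balaban1983to89.B14Thm2Assembly
import Literature.MathematicalPhysics.QuantumFieldTheory.Balaban1983to89.Node00.Record13CoPH

/-!
# DAG node N11 — [III] THEOREM 2's 𝐑-SIDE (2.44)_j AT THE ₁₃ OBJECTS FROM ITS PRINTED PROOF SENTENCE (p. 283, last paragraph: «all the terms … can be bounded by
# O(1)(LʲL⁻ⁿ)⁴ g_j^{κ₀} exp(−κd_j(X)), and this yields the inequality (2.44)») — with [II] (1.26) ON THE TORUS DISCHARGED (`TreeLengthTorus.ineq126_torus`)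

Cell `pub-ymgap`, YM-PLAN Track A (HUMAN RULING D-0062 ∕ D-0149), seat `pub-ymgap-dag-n11-w2` (g0), route `BalabanUVNodes`, key item K1⁷ `StabilityBAtRecordR13SepCoPH` =
stmt-QuantumFields-20542 (helper, count-neutral).  Companion of this seat's `BalabanUVNodesN11Thm2Ineq249AtRecord13CoPH` (file 1), whose binder `h244` is (2.44)_j — THE
LARGE-FIELD 𝐑-OPERATION SENTENCE of [III] Thm 2 — read on the (2.30) summand `Σ_{X ∈ 𝐃_j, admR} Re[𝐑^{(j)}(X,U) − 𝐑^{(j)}(X,1)]` of the witness at the record.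
[III] = [Balaban1988Convergent], [II] = [Balaban1988RG2Cluster].

WHY THIS FILE.  [III] p. 283 proves (2.44) in one paragraph: *«We analyze these functions as above, but we stop at the identity (3.49), where 𝐄^{(2)}(X, x, y, z) is replaced
by 𝐑^{(2)}(X, x, y), and z is an arbitrary point from X. Now all the terms on the right-hand side can be bounded by O(1)(LʲL⁻ⁿ)⁴g_j^{κ₀} exp(−κd_j(X)), and this yields the
inequality (2.44).»*  The cell's Literature types this over the ABSTRACT carriers: `B14Sect3.Rep244` ∕ `B14.Thm2Assembly.perPointR_of_domainBound` (per-point term from the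
per-domain bound by (1.26) over any `B12TreeDecay.CubeSystem`) and `B14Sect3.pointSum_le` (the p. 263 point count).  At NODE 00's record the localization domains ARE the
torus catalogue: `Sect2.domSys (F.P K) M j = TreeLengthTorus.tsys d (domCount …)` with the concrete cube system `tcubeSys`, for which (1.26) is a THEOREM with explicit
constants (`ineq126_torus`: κ ≥ κ₀(4·2^d, 2d) ⇒ `Σ_{X ∋ □} e^{−κd_j(X)} ≤ K₀(4·2^d, 2d)`; `tdegreeLE`, `tvolumeLeaf`).  THIS FILE assembles: p. 283's per-domain sentence at the
domains of record (attached to «an arbitrary point from X» = a chosen cube `pick X ∈ X` with its scale `n = sc (pick X)`) + the p. 263 cube count ⇒ file 1's `h244` at scale `j`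
with the ABSOLUTE constant `R₁ = O(1)·K₀(4·2^d, 2d)` — (1.26) no longer a hypothesis.

WHAT THIS FILE PROVES (0 `sorry`, 0 `def`, standard axioms; count-neutral; nothing of Bałaban's asserted — the per-domain sentence and the count are HYPOTHESES, displayed).
§1 generic over a torus catalogue `tsys d Nc`: `sum_adm_eq_sum_fiber_pick` (the admissible X-sum regrouped by the chosen cube), `fiber_abs_le_of_perDomain` (one cube: (1.26) on
the torus × the per-domain bound ⇒ `|Σ_{X: pick X = z}| ≤ c·K₀·(L^{j−n_z})⁴·g^{κ₀}`), ★ `rSummand_abs_le_of_perDomain` (all cubes, p. 263 count ⇒ `|Σ_X admR·r(X)| ≤ (c·K₀·g^{κ₀})·Σ_{n=j}^{k} Γ_n`).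
§2 at the ₁₃ objects: ★★ `h244_at_record₁₃CoPH_of_perDomain` — file 1's binder `h244` at scale `j` for the witness `t.R` over `𝐃_j` of record at `settingOfRecord₁₃`∕`θ.rzAt p s`,
from p. 283's per-domain sentence on `Re[𝐑^{(j)}(X,(ιU,0)) − 𝐑^{(j)}(X,(ι1,0))]`, a cube choice `pick`, a scale map `sc` with `j ≤ sc ≤ k` and the cube count; `R₁ = c·K₀(4·2^{d}, 2d)`.

HONEST FRAMING.  Count-neutral kernel bookkeeping; the per-domain bound IS [III] §3's analysis ((3.44)–(3.49) with 𝐑^{(2)} in place of 𝐄^{(2)}; nobody's theorem in the tree —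
n11-b's `B14Eq347Letters`∕`B14Eq347Torus` type the (3.44)–(3.47) letters), the cube count is the p. 263 sentence «|Γ_n∩Ω| means the number of points in Γ_n∩Ω ⊂ T₁^{(n)}» read for
cubes.  N11 NOT discharged; K1⁷ NOT closed; counts unmoved (typed 28∕28 · discharged 5∕27).  One finite four-torus programme at fixed `ε = L^{−K}`; R4 closes only the
conditional finite-𝕋⁴ rung `BalabanLadder.UV`; NOT ℝ⁴, NOT OS, NOT a mass gap, NOT Clay.  Sources: [III] (2.44) p. 263, p. 283, (2.30) p. 260; [II] (1.26) p. 8.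
-/

noncomputable section

open scoped BigOperators Matrix.Norms.L2Operator

namespace Summit.QuantumFields.YangMills.Theorems.BalabanUVNodesN11Thm2RSideAtRecord13CoPH

open Literature.MathematicalPhysics.QuantumFieldTheory.Balaban1983to89 Step B12TreeDecay TreeLengthTorus Finset
open T4Continuum Node00

/-! ## §1. Generic over a torus catalogue: p. 283's per-domain sentence + (1.26) on the torus + the p. 263 count ⇒ (2.44)_j's shape -/

section Torus

variable {d Nc : ℕ} [NeZero Nc]

/-- The admissible X-sum regrouped by the chosen cube («z is an arbitrary point from X», p. 283): `Σ_X adm·r(X) = Σ_{z ∈ pick(adm)} Σ_{X: adm, pick X = z} r(X)`.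
[cite: Balaban1988Convergent, p.283 (bookkeeping)] -/
theorem sum_adm_eq_sum_fiber_pick (r : (tsys d Nc).Dom → ℝ) (adm : (tsys d Nc).Dom → Bool) (pick : (tsys d Nc).Dom → TPt d Nc) :
    ∑ X : (tsys d Nc).Dom, (if adm X then r X else 0) =
      ∑ z ∈ (univ.filter fun X => adm X = true).image pick, ∑ X ∈ (univ.filter fun X => adm X = true).filter (fun X => pick X = z), r X := by
  classical
  rw [← Finset.sum_filter]
  exact (Finset.sum_fiberwise_of_maps_to (fun X hX => Finset.mem_image_of_mem pick hX) r).symm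

/-- **One chosen cube**: if every admissible `X` with `pick X = z` satisfies p. 283's per-domain bound `|r(X)| ≤ c·s⁴·g^{κ₀}·e^{−κd_j(X)}` and contains the cube `z`, then
`|Σ_{X: adm, pick X = z} r(X)| ≤ c·K₀(4·2^d, 2d)·s⁴·g^{κ₀}` for `κ ≥ κ₀(4·2^d, 2d)` — [II] (1.26) on the torus (`ineq126_torus` through `B14.Thm2Assembly.perPointR_of_domainBound` at
`tcubeSys`). [cite: Balaban1988Convergent, p.283; Balaban1988RG2Cluster, (1.26) p.8] -/
theorem fiber_abs_le_of_perDomain (r : (tsys d Nc).Dom → ℝ) (adm : (tsys d Nc).Dom → Bool) (pick : (tsys d Nc).Dom → TPt d Nc)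
    (hpick : ∀ X, adm X = true → pick X ∈ X.1) {κ c s g : ℝ} {κ₀' : ℕ} (hκ : kappa₀ (4 * 2 ^ d) (2 * d) ≤ κ) (hc : 0 ≤ c) (hs : 0 ≤ s)
    (hg : 0 ≤ g) (z : TPt d Nc)
    (hr : ∀ X, adm X = true → pick X = z → |r X| ≤ c * s ^ 4 * g ^ κ₀' * Real.exp (-κ * (tsys d Nc).dj X)) :
    |∑ X ∈ (univ.filter fun X => adm X = true).filter (fun X => pick X = z), r X| ≤ c * K₀ (4 * 2 ^ d) (2 * d) * s ^ 4 * g ^ κ₀' := by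
  classical
  have hset : (univ.filter fun X : (tsys d Nc).Dom => adm X = true).filter (fun X => pick X = z) =
      ((tcubeSys d Nc).above z).filter (fun X => adm X = true ∧ pick X = z) := by
    ext X
    simp only [Finset.mem_filter, Finset.mem_univ, true_and, CubeSystem.mem_above, tcubeSys_cubes]
    constructor
    · rintro ⟨ha, hp⟩
      exact ⟨hp ▸ hpick X ha, ha, hp⟩
    · rintro ⟨-, ha, hp⟩
      exact ⟨ha, hp⟩
  rw [hset, Finset.sum_filter]
  refine B14.Thm2Assembly.perPointR_of_domainBound (tcubeSys d Nc) (tdegreeLE d Nc) (tvolumeLeaf d Nc) hκ hc hs hg z fun X _ => ?_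
  by_cases h : adm X = true ∧ pick X = z
  · rw [if_pos h]
    exact hr X h.1 h.2
  · rw [if_neg h, abs_zero]
    positivity

/-- **★ (2.44)_j's SHAPE FROM p. 283's PER-DOMAIN SENTENCE on a torus catalogue**: admissible domains `X` carry a chosen cube `pick X ∈ X` of scale `n = sc(pick X) ∈ [j, k]`
and the bound `|r(X)| ≤ c·(L^{j−n})⁴·g^{κ₀}·e^{−κd_j(X)}`; the chosen cubes of scale `n` number at most `(L^{n−j})⁴·Γ_n` (p. 263 count); κ ≥ κ₀(4·2^d, 2d).  THEN
`|Σ_X adm·r(X)| ≤ (c·K₀(4·2^d,2d)·g^{κ₀})·Σ_{n=j}^{k} Γ_n` — (2.44) at one `(j, k, Ω)` with the absolute constant `R₁ = c·K₀`.  Kernel: fibres by `pick` + `fiber_abs_le_of_perDomain` +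
`B14Sect3.pointSum_le` (exponent 4 − 4 = 0). [cite: Balaban1988Convergent, (2.44) p.263, p.283; Balaban1988RG2Cluster, (1.26) p.8] -/
theorem rSummand_abs_le_of_perDomain (r : (tsys d Nc).Dom → ℝ) (adm : (tsys d Nc).Dom → Bool) (pick : (tsys d Nc).Dom → TPt d Nc)
    (hpick : ∀ X, adm X = true → pick X ∈ X.1) (sc : TPt d Nc → ℕ) (j k : ℕ) (hsc : ∀ X, adm X = true → j ≤ sc (pick X) ∧ sc (pick X) ≤ k)
    {κ c L g : ℝ} {κ₀' : ℕ} (hκ : kappa₀ (4 * 2 ^ d) (2 * d) ≤ κ) (hc : 0 ≤ c) (hL : 0 < L) (hg : 0 ≤ g)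
    (hr : ∀ X, adm X = true → |r X| ≤ c * (L ^ ((j : ℝ) - sc (pick X))) ^ 4 * g ^ κ₀' * Real.exp (-κ * (tsys d Nc).dj X))
    (Γ : ℕ → ℝ)
    (hcount : ∀ n, ((((univ.filter fun X => adm X = true).image pick).filter (fun z => sc z = n)).card : ℝ) ≤ (L ^ ((n : ℝ) - j)) ^ (4 : ℝ) * Γ n) :
    |∑ X : (tsys d Nc).Dom, (if adm X then r X else 0)| ≤ (c * K₀ (4 * 2 ^ d) (2 * d) * g ^ κ₀') * ∑ n ∈ Icc j k, Γ n := by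
  classical
  rw [sum_adm_eq_sum_fiber_pick]
  set Z := (univ.filter fun X : (tsys d Nc).Dom => adm X = true).image pick with hZ
  have hK : 0 ≤ K₀ (4 * 2 ^ d) (2 * d) := by unfold K₀; positivity
  have hcz : 0 ≤ c * K₀ (4 * 2 ^ d) (2 * d) * g ^ κ₀' := mul_nonneg (mul_nonneg hc hK) (pow_nonneg hg _)
  have hscZ : ∀ z ∈ Z, j ≤ sc z ∧ sc z ≤ k := by
    intro z hz
    obtain ⟨X, hX, rfl⟩ := Finset.mem_image.mp hz
    exact hsc X (Finset.mem_filter.mp hX).2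
  have ht : ∀ z ∈ Z, |∑ X ∈ (univ.filter fun X => adm X = true).filter (fun X => pick X = z), r X| ≤
      (c * K₀ (4 * 2 ^ d) (2 * d) * g ^ κ₀') * (L ^ ((j : ℝ) - sc z)) ^ (4 : ℝ) := by
    intro z _
    have h := fiber_abs_le_of_perDomain r adm pick hpick hκ hc (Real.rpow_nonneg hL.le ((j : ℝ) - sc z)) hg z
      (κ₀' := κ₀') fun X ha hp => by rw [← hp]; exact hr X ha
    have e : (L ^ ((j : ℝ) - sc z)) ^ (4 : ℝ) = (L ^ ((j : ℝ) - sc z)) ^ 4 := by exact_mod_cast Real.rpow_natCast (L ^ ((j : ℝ) - sc z)) 4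
    rw [e]
    calc |∑ X ∈ (univ.filter fun X => adm X = true).filter (fun X => pick X = z), r X|
        ≤ c * K₀ (4 * 2 ^ d) (2 * d) * (L ^ ((j : ℝ) - sc z)) ^ 4 * g ^ κ₀' := h
      _ = (c * K₀ (4 * 2 ^ d) (2 * d) * g ^ κ₀') * (L ^ ((j : ℝ) - sc z)) ^ 4 := by ring
  have hmain := B14Sect3.pointSum_le Z sc (fun z => ∑ X ∈ (univ.filter fun X => adm X = true).filter (fun X => pick X = z), r X) j k L
    (c * K₀ (4 * 2 ^ d) (2 * d) * g ^ κ₀') 4 Γ hL hcz hscZ ht hcount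
  have e : ∀ n : ℕ, (L ^ ((j : ℝ) - n)) ^ ((4 : ℝ) - 4) = 1 := fun n => by rw [sub_self, Real.rpow_zero]
  simp only [e, one_mul] at hmain
  exact hmain

end Torus

/-! ## §2. At the ₁₃ objects: file 1's binder `h244` at scale `j` from p. 283's per-domain sentence on the witness's 𝐑-terms over `𝐃_j` of record -/

section AtRecord13

variable {F : T4Family} {N : ℕ} [NeZero N]
variable (θ : Stage13HParams F N) (p : B12.RunParams) {k : ℕ}

/-- **★★ (2.44)_j AT NODE 00's STAGE-13 OBJECTS FROM ITS PRINTED PROOF SENTENCE** (p. 283): for the history `s`, the witness `t` (its 𝐑-terms `t.R j X` over `𝐃_j` of record =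
the torus catalogue `Sect2.domSys (F.P p.K) θ.τ9.M j`), the (2.30) range `Sect2.admR … s.Λ j` and the configuration `U`: IF every admissible `X` carries a chosen cube `pick X ∈ X`
of scale `sc(pick X) ∈ [j, k]` with «all the terms … bounded by O(1)(LʲL⁻ⁿ)⁴ g_j^{κ₀} exp(−κd_j(X))» (`hr`, on `Re[𝐑^{(j)}(X,(ιU,0)) − 𝐑^{(j)}(X,(ι1,0))]`), the chosen cubes of
scale `n` number ≤ `(L^{n−j})⁴·Γ_n` (`hcount`), and `κ ≥ κ₀(4·2^d, 2d)`, THEN file 1's binder `h244` holds at scale `j` with `R₁ = c·K₀(4·2^d, 2d)`: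
`|Σ_X admR·Re[𝐑^{(j)}(X,U) − 𝐑^{(j)}(X,1)]| ≤ (c·K₀)·g_j^{κ₀}·Σ_{n=j}^{k} Γ_n`, `g_j = gOfRecord₁₃ … p j`.  [II] (1.26) is DISCHARGED on the torus (`ineq126_torus`).
[cite: Balaban1988Convergent, (2.44) p.263, p.283, (2.30) p.260; Balaban1988RG2Cluster, (1.26) p.8] -/
theorem h244_at_record₁₃CoPH_of_perDomain (s : SeqOfRecord F θ.ν θ.τ9.M (gOfRecord₁₃ F N θ.toStage13Params p) p.K k)
    (t : Sect2.TermValues (F.P p.K) (MatA N) (FluctV N) θ.τ9.M) (U : GaugeField (F.P p.K) 0 (SU N)) (j : ℕ)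
    (pick : (Sect2.domSys (F.P p.K) θ.τ9.M j).Dom → TPt (F.P p.K).d (Sect2.domCount (F.P p.K) θ.τ9.M j))
    (hpick : ∀ X, Sect2.admR (F.P p.K) θ.ν θ.τ9.M (gOfRecord₁₃ F N θ.toStage13Params p) s.Λ j (Sect2.domSites (F.P p.K) θ.τ9.M j X) = true → pick X ∈ X.1)
    (sc : TPt (F.P p.K).d (Sect2.domCount (F.P p.K) θ.τ9.M j) → ℕ)
    (hsc : ∀ X, Sect2.admR (F.P p.K) θ.ν θ.τ9.M (gOfRecord₁₃ F N θ.toStage13Params p) s.Λ j (Sect2.domSites (F.P p.K) θ.τ9.M j X) = true →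
      j ≤ sc (pick X) ∧ sc (pick X) ≤ k)
    {κ c L : ℝ} {κ₀ : ℕ} (hκ : kappa₀ (4 * 2 ^ (F.P p.K).d) (2 * (F.P p.K).d) ≤ κ) (hc : 0 ≤ c) (hL : 0 < L)
    (hg : 0 ≤ gOfRecord₁₃ F N θ.toStage13Params p j)
    (hr : ∀ X, Sect2.admR (F.P p.K) θ.ν θ.τ9.M (gOfRecord₁₃ F N θ.toStage13Params p) s.Λ j (Sect2.domSites (F.P p.K) θ.τ9.M j X) = true →
      |(t.R j X (Sect2.ofBackgroundC (ιSU N) U)).re - (t.R j X (Sect2.ofBackgroundC (ιSU N) 1)).re| ≤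
        c * (L ^ ((j : ℝ) - sc (pick X))) ^ 4 * (gOfRecord₁₃ F N θ.toStage13Params p j) ^ κ₀ *
          Real.exp (-κ * (Sect2.domSys (F.P p.K) θ.τ9.M j).dj X))
    (Γ : ℕ → ℝ)
    (hcount : ∀ n, ((((univ.filter fun X => Sect2.admR (F.P p.K) θ.ν θ.τ9.M (gOfRecord₁₃ F N θ.toStage13Params p) s.Λ j (Sect2.domSites (F.P p.K) θ.τ9.M j X) = true).image
        pick).filter (fun z => sc z = n)).card : ℝ) ≤ (L ^ ((n : ℝ) - j)) ^ (4 : ℝ) * Γ n) :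
    |∑ X : (Sect2.domSys (F.P p.K) θ.τ9.M j).Dom, (if Sect2.admR (F.P p.K) θ.ν θ.τ9.M (gOfRecord₁₃ F N θ.toStage13Params p) s.Λ j (Sect2.domSites (F.P p.K) θ.τ9.M j X) then
        ((t.R j X (Sect2.ofBackgroundC (ιSU N) U)).re - (t.R j X (Sect2.ofBackgroundC (ιSU N) 1)).re) else 0)| ≤
      (c * K₀ (4 * 2 ^ (F.P p.K).d) (2 * (F.P p.K).d)) * (gOfRecord₁₃ F N θ.toStage13Params p j) ^ κ₀ * ∑ n ∈ Icc j k, Γ n := by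
  have h := rSummand_abs_le_of_perDomain (d := (F.P p.K).d) (Nc := Sect2.domCount (F.P p.K) θ.τ9.M j)
    (fun X => (t.R j X (Sect2.ofBackgroundC (ιSU N) U)).re - (t.R j X (Sect2.ofBackgroundC (ιSU N) 1)).re)
    (fun X => Sect2.admR (F.P p.K) θ.ν θ.τ9.M (gOfRecord₁₃ F N θ.toStage13Params p) s.Λ j (Sect2.domSites (F.P p.K) θ.τ9.M j X))
    pick hpick sc j k hsc hκ hc hL hg hr Γ hcount
  calc _ ≤ (c * K₀ (4 * 2 ^ (F.P p.K).d) (2 * (F.P p.K).d) * (gOfRecord₁₃ F N θ.toStage13Params p j) ^ κ₀) * ∑ n ∈ Icc j k, Γ n := h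
    _ = _ := by ring

end AtRecord13

end Summit.QuantumFields.YangMills.Theorems.BalabanUVNodesN11Thm2RSideAtRecord13CoPH

end
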